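import Mathlib
import HarnessLib
import Literature.Analysis.FluidPDE.SelfSimilar
import Summits.NavierStokesRegularity.NavierStokesRegularity.Theorems.LocalSineTubeDoorProfileAlignedWindowRigidityAncient

/-!
# Route `PoloidalWindowDoor`, crux `PoloidalWindowRigidity` (K2, stmt-NavierStokesRegularity-19708) — LINE 2 `string_shells` (ns-idea-8 g0, lens «barrier»),
# STUB `stub_thGlobalLaw`: the (TH) slope law continues, in RATIO FORM, from the window to every height and every time (kinematic, M−)

Cell ns-regularity-ideate, seat ns-poloidal-K2-p2 g12 (stub-worker on K2; `--supports` the crux item).  Statement VERBATIM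
`Cruxes/PoloidalWindowRigidity/Lines/string_shells.lean` l.91–106.

CLAIM.  A profile of the route's Type-I class (rate, continuity on the open slab, Oseen-mildness (M), incompressibility) satisfying the (TH) slope law
`∂_z v_b(s,y) = m(s, y₂)·∂_b w(s,y)` (`b = 0,1`, `w = v₂`) at the points of an open non-empty space–time window `W` satisfies the RATIO FORM
`∂_z v_b(s,y)·∂_{b'} w(s,y') = ∂_z v_{b'}(s,y')·∂_b w(s,y)` for EVERY `s < 0` and EVERY pair `y, y'` of the same height, `b, b' ∈ {0,1}`.
PROOF.  Class profiles are JOINTLY real-analytic on `{s < 0} × ℝ³` (tree `…LocalSineTubeDoorProfileAlignedWindowRigidityAncient.analyticOnNhd_uncurry`,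
from `bdd_of_hasTypeITimeDecay`), hence so is `(s,y) ↦ Dv(s)(y)` (`AnalyticOnNhd.fderiv`; the spatial derivative is the joint derivative on
`(0, e)`, `fderiv_slice_eq`).  For fixed `b, b'` the defect `F(s, y, h) := ∂_z v_b(s,y)·∂_{b'}w(s,y') − ∂_z v_{b'}(s,y')·∂_b w(s,y)` with
`y' := (h₀, h₁, y₂)` is real-analytic on the connected open set `{s < 0} × ℝ³ × ℝ²` and vanishes on the open non-empty set of `(s,y,h)` with
`(s,y), (s,y') ∈ W` (there both sides equal `m(s,y₂) ∂_b w(y) ∂_{b'} w(y')`); by the identity theorem it vanishes identically.  (M) is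
load-bearing through analyticity (minus (M) the statement is false: `C^∞` bump modification off the window).

WHAT THIS IS NOT: not a claim about Navier–Stokes regularity — one kinematic stub of an ideator line of a door route (bears_on LADDER-NS N0, rung
N0-LocalTubeDoorPoloidal); the line's deciding stubs (`stub_stringShellsTH`, `stub_turningHeightTH`, `stub_shortStringTH`, the shared thick stubs)
stay OPEN; crux 19708 OPEN.
-/

noncomputable section

-- the summit and its single sub-problem share the name (CONVENTIONS §1), as in every Theorems file
set_option linter.dupNamespace false

namespace Summit.NavierStokesRegularity.NavierStokesRegularity.Theorems.PoloidalWindowDoorPoloidalWindowRigidityTHGlobalLaw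

open Set Function Filter Topology Metric
open scoped RealInnerProductSpace InnerProductSpace
open Literature.Analysis Literature.Analysis.FluidPDE
open Summit.NavierStokesRegularity.NavierStokesRegularity.Theorems.LocalSineTubeDoorProfileAlignedWindowRigidityAncient

/-- **Spatial derivatives are joint derivatives on `(0, e)`**: if `Φ = uncurry v` is differentiable at `(s, y)` then
`D(v s)(y) e = DΦ(s,y)(0, e)`. [folklore] -/
theorem fderiv_slice_eq {v : ℝ → EuclideanSpace ℝ (Fin 3) → EuclideanSpace ℝ (Fin 3)} {s : ℝ} {y : EuclideanSpace ℝ (Fin 3)}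
    (h : DifferentiableAt ℝ (uncurry v) (s, y)) (e : EuclideanSpace ℝ (Fin 3)) :
    fderiv ℝ (v s) y e = fderiv ℝ (uncurry v) (s, y) ((0 : ℝ), e) := by
  have hinr : HasFDerivAt (fun y' : EuclideanSpace ℝ (Fin 3) => ((s, y') : ℝ × EuclideanSpace ℝ (Fin 3)))
      (ContinuousLinearMap.inr ℝ ℝ (EuclideanSpace ℝ (Fin 3))) y := (hasFDerivAt_prodMk_right s y)
  have hcomp := h.hasFDerivAt.comp y hinr
  have e1 : (uncurry v) ∘ (fun y' : EuclideanSpace ℝ (Fin 3) => ((s, y') : ℝ × EuclideanSpace ℝ (Fin 3))) = v s := by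
    funext y'; rfl
  rw [e1] at hcomp
  rw [hcomp.fderiv, ContinuousLinearMap.comp_apply, ContinuousLinearMap.inr_apply]

/-- **Joint real-analyticity of the spatial-derivative entries** `(s,y) ↦ (D(v s)(y) e)ᵢ` on `{s < 0} × ℝ³` for a class profile. [folklore] -/
theorem analyticOnNhd_fderiv_entry {C : ℝ} {v : ℝ → EuclideanSpace ℝ (Fin 3) → EuclideanSpace ℝ (Fin 3)} (hrate : HasTypeITimeDecay C v)
    (hcont : ContinuousOn (uncurry v) (Iio (0 : ℝ) ×ˢ univ))
    (hmild : ∀ s t : ℝ, s < t → t < 0 → ∀ x, v t x = UnboundedOperators.heatExtension (v s) (t - s) x - oseenDuhamel 1 s v v t x)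
    (e : EuclideanSpace ℝ (Fin 3)) (i : Fin 3) :
    AnalyticOnNhd ℝ (fun p : ℝ × EuclideanSpace ℝ (Fin 3) => fderiv ℝ (v p.1) p.2 e i) (Iio (0 : ℝ) ×ˢ univ) := by
  have han : AnalyticOnNhd ℝ (uncurry v) (Iio (0 : ℝ) ×ˢ univ) := analyticOnNhd_uncurry hcont (bdd_of_hasTypeITimeDecay hrate) hmild
  have hD : AnalyticOnNhd ℝ (fderiv ℝ (uncurry v)) (Iio (0 : ℝ) ×ˢ univ) := han.fderiv
  intro p hp
  have hpD : DifferentiableAt ℝ (uncurry v) p := (han p hp).differentiableAt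
  -- near `p` the slice derivative is the joint derivative on `(0, e)`
  have hopen : IsOpen (Iio (0 : ℝ) ×ˢ (univ : Set (EuclideanSpace ℝ (Fin 3)))) := isOpen_Iio.prod isOpen_univ
  have hev : (fun q : ℝ × EuclideanSpace ℝ (Fin 3) => fderiv ℝ (v q.1) q.2 e i) =ᶠ[𝓝 p]
      fun q => (EuclideanSpace.proj (𝕜 := ℝ) i) ((fderiv ℝ (uncurry v) q) ((0 : ℝ), e)) := by
    filter_upwards [hopen.mem_nhds hp] with q hq
    have hq' : DifferentiableAt ℝ (uncurry v) (q.1, q.2) := (han q hq).differentiableAt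
    show fderiv ℝ (v q.1) q.2 e i = (fderiv ℝ (uncurry v) q ((0 : ℝ), e)) i
    rw [fderiv_slice_eq hq' e]
  refine (AnalyticAt.congr ?_ hev.symm)
  have h1 : AnalyticAt ℝ (fun q : ℝ × EuclideanSpace ℝ (Fin 3) => (fderiv ℝ (uncurry v) q) ((0 : ℝ), e)) p :=
    (ContinuousLinearMap.apply ℝ (EuclideanSpace ℝ (Fin 3)) ((0 : ℝ), e)).analyticAt _ |>.comp (hD p hp)
  exact ((EuclideanSpace.proj (𝕜 := ℝ) i).analyticAt _).comp h1

/-- **STUB `stub_thGlobalLaw` of LINE 2 `string_shells` (VERBATIM): the (TH) slope law in ratio form holds at every height and every time.**  See the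
module docstring for the proof. -/
theorem stub_thGlobalLaw :
    ∀ (C : ℝ) (v : ℝ → EuclideanSpace ℝ (Fin 3) → EuclideanSpace ℝ (Fin 3)),
      Literature.Analysis.FluidPDE.HasTypeITimeDecay C v →
      ContinuousOn (Function.uncurry v) (Set.Iio (0 : ℝ) ×ˢ Set.univ) →
      (∀ s t : ℝ, s < t → t < 0 → ∀ x, v t x =
        Literature.Analysis.UnboundedOperators.heatExtension (v s) (t - s) x -
          Literature.Analysis.FluidPDE.oseenDuhamel 1 s v v t x) →
      (∀ t < 0, Literature.Analysis.FluidPDE.VectorCalculus.IsDivFree (v t)) →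
      ∀ W : Set (ℝ × EuclideanSpace ℝ (Fin 3)), IsOpen W → W.Nonempty → W ⊆ Set.Iio (0 : ℝ) ×ˢ Set.univ →
        (∃ m : ℝ → ℝ → ℝ, ∀ z ∈ W, ∀ b : Fin 3, b ≠ 2 →
          fderiv ℝ (v z.1) z.2 (EuclideanSpace.single 2 1) b =
            m z.1 (z.2 2) * fderiv ℝ (v z.1) z.2 (EuclideanSpace.single b 1) 2) →
        ∀ s : ℝ, s < 0 → ∀ y y' : EuclideanSpace ℝ (Fin 3), y 2 = y' 2 → ∀ b b' : Fin 3, b ≠ 2 → b' ≠ 2 →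
          fderiv ℝ (v s) y (EuclideanSpace.single 2 1) b * fderiv ℝ (v s) y' (EuclideanSpace.single b' 1) 2 =
            fderiv ℝ (v s) y' (EuclideanSpace.single 2 1) b' * fderiv ℝ (v s) y (EuclideanSpace.single b 1) 2 := by
  intro C v hrate hcont hmild _hdiv W hW hWne hWsub hlaw s hs y y' hyy' b b' hb hb'
  obtain ⟨m, hm⟩ := hlaw
  -- the entries as jointly analytic functions of `(s, y)`
  set g : EuclideanSpace ℝ (Fin 3) → Fin 3 → ℝ × EuclideanSpace ℝ (Fin 3) → ℝ := fun e i p => fderiv ℝ (v p.1) p.2 e i with hg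
  have hga : ∀ e i, AnalyticOnNhd ℝ (g e i) (Iio (0 : ℝ) ×ˢ univ) := fun e i => analyticOnNhd_fderiv_entry hrate hcont hmild e i
  -- the parameter space `(s, y, h)` and the two base-point maps
  set Y' : EuclideanSpace ℝ (Fin 3) → EuclideanSpace ℝ (Fin 2) → EuclideanSpace ℝ (Fin 3) := fun y h =>
    EuclideanSpace.single 0 (h 0) + EuclideanSpace.single 1 (h 1) + EuclideanSpace.single 2 (y 2) with hY'
  set π₁ : ℝ × EuclideanSpace ℝ (Fin 3) × EuclideanSpace ℝ (Fin 2) → ℝ × EuclideanSpace ℝ (Fin 3) := fun q => (q.1, q.2.1) with hπ₁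
  set π₂ : ℝ × EuclideanSpace ℝ (Fin 3) × EuclideanSpace ℝ (Fin 2) → ℝ × EuclideanSpace ℝ (Fin 3) := fun q => (q.1, Y' q.2.1 q.2.2) with hπ₂
  -- linearity / analyticity of the base-point maps
  let L0 : EuclideanSpace ℝ (Fin 3) →L[ℝ] EuclideanSpace ℝ (Fin 3) :=
    (EuclideanSpace.proj (𝕜 := ℝ) (2 : Fin 3)).smulRight (EuclideanSpace.single 2 1)
  let L1 : EuclideanSpace ℝ (Fin 2) →L[ℝ] EuclideanSpace ℝ (Fin 3) :=
    (EuclideanSpace.proj (𝕜 := ℝ) (0 : Fin 2)).smulRight (EuclideanSpace.single 0 1) +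
      (EuclideanSpace.proj (𝕜 := ℝ) (1 : Fin 2)).smulRight (EuclideanSpace.single 1 1)
  have hY'lin : ∀ y h, Y' y h = L0 y + L1 h := by
    intro y h; ext i; fin_cases i <;> simp [hY', L0, L1]
  have hπ₁a : AnalyticOnNhd ℝ π₁ univ := fun q _ =>
    (analyticAt_fst (𝕜 := ℝ) (p := q)).prod (analyticAt_fst.comp analyticAt_snd)
  have hπ₂a : AnalyticOnNhd ℝ π₂ univ := by
    intro q _
    have h2 : AnalyticAt ℝ (fun q : ℝ × EuclideanSpace ℝ (Fin 3) × EuclideanSpace ℝ (Fin 2) => Y' q.2.1 q.2.2) q := by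
      have e : (fun q : ℝ × EuclideanSpace ℝ (Fin 3) × EuclideanSpace ℝ (Fin 2) => Y' q.2.1 q.2.2) =
          fun q => L0 q.2.1 + L1 q.2.2 := funext fun q => hY'lin _ _
      rw [e]
      exact ((L0.analyticAt _).comp (analyticAt_fst.comp analyticAt_snd)).add
        ((L1.analyticAt _).comp (analyticAt_snd.comp analyticAt_snd))
    exact (analyticAt_fst (𝕜 := ℝ) (p := q)).prod h2
  -- the domain `D = {s < 0}` in the parameter space
  set D : Set (ℝ × EuclideanSpace ℝ (Fin 3) × EuclideanSpace ℝ (Fin 2)) :=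
    Iio (0 : ℝ) ×ˢ (univ : Set (EuclideanSpace ℝ (Fin 3) × EuclideanSpace ℝ (Fin 2))) with hD
  have hπ₁D : MapsTo π₁ D (Iio (0 : ℝ) ×ˢ univ) := fun q hq => ⟨hq.1, mem_univ _⟩
  have hπ₂D : MapsTo π₂ D (Iio (0 : ℝ) ×ˢ univ) := fun q hq => ⟨hq.1, mem_univ _⟩
  -- the defect
  set e2 : EuclideanSpace ℝ (Fin 3) := EuclideanSpace.single 2 1 with he2
  set eb : EuclideanSpace ℝ (Fin 3) := EuclideanSpace.single b 1 with heb
  set eb' : EuclideanSpace ℝ (Fin 3) := EuclideanSpace.single b' 1 with heb'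
  set F : ℝ × EuclideanSpace ℝ (Fin 3) × EuclideanSpace ℝ (Fin 2) → ℝ := fun q =>
    g e2 b (π₁ q) * g eb' 2 (π₂ q) - g e2 b' (π₂ q) * g eb 2 (π₁ q) with hF
  have hFa : AnalyticOnNhd ℝ F D := by
    intro q hq
    have h1 : AnalyticAt ℝ (fun q => g e2 b (π₁ q)) q := (hga e2 b _ (hπ₁D hq)).comp (hπ₁a q (mem_univ _))
    have h2 : AnalyticAt ℝ (fun q => g eb' 2 (π₂ q)) q := (hga eb' 2 _ (hπ₂D hq)).comp (hπ₂a q (mem_univ _))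
    have h3 : AnalyticAt ℝ (fun q => g e2 b' (π₂ q)) q := (hga e2 b' _ (hπ₂D hq)).comp (hπ₂a q (mem_univ _))
    have h4 : AnalyticAt ℝ (fun q => g eb 2 (π₁ q)) q := (hga eb 2 _ (hπ₁D hq)).comp (hπ₁a q (mem_univ _))
    exact (h1.mul h2).sub (h3.mul h4)
  have hDconn : IsPreconnected D := ((convex_Iio (0 : ℝ)).prod convex_univ).isPreconnected
  -- `F` vanishes on the window pairs
  obtain ⟨z₀, hz₀⟩ := hWne
  set q₀ : ℝ × EuclideanSpace ℝ (Fin 3) × EuclideanSpace ℝ (Fin 2) :=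
    (z₀.1, z₀.2, EuclideanSpace.single 0 (z₀.2 0) + EuclideanSpace.single 1 (z₀.2 1)) with hq₀
  have hY'self : ∀ x : EuclideanSpace ℝ (Fin 3), Y' x (EuclideanSpace.single 0 (x 0) + EuclideanSpace.single 1 (x 1)) = x := by
    intro x; ext i; fin_cases i <;> simp [hY']
  have hq₀D : q₀ ∈ D := ⟨(hWsub hz₀).1, mem_univ _⟩
  have hπ₁c : Continuous π₁ := continuousOn_univ.1 hπ₁a.continuousOn
  have hπ₂c : Continuous π₂ := continuousOn_univ.1 hπ₂a.continuousOn
  have hA : ∀ᶠ q in 𝓝 q₀, π₁ q ∈ W ∧ π₂ q ∈ W := by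
    have h1 : ∀ᶠ q in 𝓝 q₀, π₁ q ∈ W := hπ₁c.continuousAt.preimage_mem_nhds (hW.mem_nhds (by simpa [hπ₁, hq₀] using hz₀))
    have h2 : ∀ᶠ q in 𝓝 q₀, π₂ q ∈ W := hπ₂c.continuousAt.preimage_mem_nhds (hW.mem_nhds (by
      show (z₀.1, Y' z₀.2 (EuclideanSpace.single 0 (z₀.2 0) + EuclideanSpace.single 1 (z₀.2 1))) ∈ W
      rw [hY'self]; exact hz₀))
    exact h1.and h2
  have hY'2 : ∀ x h, Y' x h 2 = x 2 := fun x h => by simp [hY']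
  have hF0 : F =ᶠ[𝓝 q₀] 0 := by
    filter_upwards [hA] with q hq
    obtain ⟨h1, h2⟩ := hq
    have e1 := hm (π₁ q) h1 b hb
    have e2 := hm (π₂ q) h2 b' hb'
    simp only [hF, hg, Pi.zero_apply]
    have hs2 : (π₂ q).2 2 = (π₁ q).2 2 := by simp only [hπ₁, hπ₂]; exact hY'2 _ _
    have ht : (π₂ q).1 = (π₁ q).1 := rfl
    rw [e1, e2, hs2, ht]
    ring
  have hzero := hFa.eqOn_zero_of_preconnected_of_eventuallyEq_zero hDconn hq₀D hF0
  -- evaluate at `(s, y, (y'₀, y'₁))`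
  set q₁ : ℝ × EuclideanSpace ℝ (Fin 3) × EuclideanSpace ℝ (Fin 2) :=
    (s, y, EuclideanSpace.single 0 (y' 0) + EuclideanSpace.single 1 (y' 1)) with hq₁
  have hq₁D : q₁ ∈ D := ⟨hs, mem_univ _⟩
  have hval := hzero hq₁D
  have hπ₂q : π₂ q₁ = (s, y') := by
    simp only [hπ₂, hq₁]
    congr 1
    ext i; fin_cases i <;> simp [hY', hyy']
  have hπ₁q : π₁ q₁ = (s, y) := rfl
  simp only [hF, hg, hπ₁q, hπ₂q, Pi.zero_apply, sub_eq_zero] at hval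
  simpa [he2, heb, heb'] using hval

end Summit.NavierStokesRegularity.NavierStokesRegularity.Theorems.PoloidalWindowDoorPoloidalWindowRigidityTHGlobalLaw
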